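import Mathlib.Analysis.Calculus.ContDiff.WithLp
import Mathlib.Analysis.InnerProductSpace.Calculus
import Mathlib.Geometry.Manifold.ContMDiff.NormedSpace
import Literature.Topology.FourManifolds.MMSWRasmussenFacts
import Summits.SmoothPoincare4.SmoothPoincare4.Theses.DottedCircleRasmussen

/-!
# Stub `stub_sectorBlind` of line `Sketch` for crux `DcrGap`
(item stmt-SmoothPoincare4-16128, route route-SmoothPoincare4-DottedCircleRasmussen)

**The MMSW invariants are blind to the sphere twists** (Manolescu–Marengon–Sarkar–Willis, Thm. 2.8
for the generators `σ_i`): for a loop `K` on the model boundary `∂D_r` and every `j ∈ ℤ`,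
`s₋(σ^j ∘ K) = s₋(K)` and `s₊(σ^j ∘ K) = s₊(K)`, as statements about `MMSW.HasSMinus` /
`MMSW.HasSPlus` and the model sphere twist `MMSW.sphereTwist r j : (z, w) ↦ (z, w · u(z)^j)`.

Proof (everything over the tree's definitions in `Literature/Topology/FourManifolds/MMSWRasmussen`).
`HasSMinus r K s` asks for null-homology of `K`, a core-missing representative `K'` isotopic to `K`
through model knots, and `s(D(k⃗)(K')) = s` for all large `k`.

* Null-homology only sees `z ∘ K`, and `z ∘ σ^j = z` (`MMSW.zC_sphereTwist`).
* The representative `σ^j ∘ K'` of `σ^j ∘ K` misses the cores (`w ↦ w · u^j`, `u ≠ 0` off the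
  poles) and `D(k⃗)(σ^j K') = D(k⃗ + j⃗)(K')` (`MMSW.finiteApprox_sphereTwist_comp`), so the
  eventual value is unchanged (threshold `k₀ - j`).
* Isotopies through model knots are transported along `σ^j`: the sphere twist is real-smooth on
  the open set `{∀ i, z ≠ c_i} ⊇ ∂D_r` (each factor `(z - c)/‖z - c‖` of `u` is smooth off `c`,
  integer powers of a nonvanishing smooth function are smooth, and `z`, `w`, `(z, w) ↦ x` are
  real-linear), so `σ^j ∘ H_s` is again a jointly smooth family; each `σ^j ∘ H_s` is a model knot:
  it lies on `∂D_r` (`MMSW.sphereTwist_mem_modelBoundary`), and injectivity of the map and of its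
  `mfderiv` follow from the left inverse `σ^{-j}` (`MMSW.sphereTwist_neg_sphereTwist`) and the chain
  rule `mfderiv (σ^{-j} ∘ σ^j ∘ L) = mfderiv σ^{-j} ∘ mfderiv (σ^j ∘ L)`.
* The converse direction is the direct one for `σ^{-j}`; the `s₊` half is the `s₋` half for the
  mirror `ρ ∘ K` and `-j`, by `ρ ∘ σ^j = σ^{-j} ∘ ρ` on `∂D_r` (`u(z̄) = conj u(z) = u(z)⁻¹`).

References: C. Manolescu, M. Marengon, S. Sarkar, M. Willis, Duke Math. J. 172 (2023), Thm. 2.8 and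
§2.3 [ManolescuMarengonSarkarWillis2023]. No `sorry`, no named facts.
-/

-- the prescribed namespace `Summit.<P>.<Sub>.…` duplicates `SmoothPoincare4` (P = Sub)
set_option linter.dupNamespace false

noncomputable section

open scoped Manifold ContDiff Topology ComplexConjugate
open Function Set
open Literature.Topology.FourManifolds Literature.Topology.FourManifolds.MMSW
open Literature.AlgebraicTopology.Homotopy.HopfFibration (zC wC ofZW zC_ofZW wC_ofZW ofZW_zC_wC)

namespace Summit.SmoothPoincare4.SmoothPoincare4.Theorems.DcrGap.Sketch

variable {r : ℕ}
  {K K' L : Metric.sphere (0 : EuclideanSpace ℝ (Fin 2)) 1 → EuclideanSpace ℝ (Fin 4)}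

/-! ## The sphere twists are smooth off the poles -/

/-- The coordinate `z : ℝ⁴ → ℂ` is real-smooth (it is real-linear). [folklore] -/
theorem sectorBlind_contDiff_zC : ContDiff ℝ ∞ zC := by
  have h : zC = fun x : EuclideanSpace ℝ (Fin 4) ↦ Complex.equivRealProdCLM.symm (x 0, x 1) := by
    funext x
    exact Complex.ext (by simp [zC]) (by simp [zC])
  rw [h]
  exact Complex.equivRealProdCLM.symm.contDiff.comp
    ((contDiff_piLp_apply 2).prodMk (contDiff_piLp_apply 2))

/-- The coordinate `w : ℝ⁴ → ℂ` is real-smooth (it is real-linear). [folklore] -/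
theorem sectorBlind_contDiff_wC : ContDiff ℝ ∞ wC := by
  have h : wC = fun x : EuclideanSpace ℝ (Fin 4) ↦ Complex.equivRealProdCLM.symm (x 2, x 3) := by
    funext x
    exact Complex.ext (by simp [wC]) (by simp [wC])
  rw [h]
  exact Complex.equivRealProdCLM.symm.contDiff.comp
    ((contDiff_piLp_apply 2).prodMk (contDiff_piLp_apply 2))

/-- The coordinate map `(z, w) ↦ (Re z, Im z, Re w, Im w) : ℂ × ℂ → ℝ⁴` is real-smooth (it is
real-linear). [folklore] -/
theorem sectorBlind_contDiff_ofZW : ContDiff ℝ ∞ (fun q : ℂ × ℂ ↦ ofZW q.1 q.2) := by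
  refine contDiff_piLp' 2 fun i ↦ ?_
  fin_cases i
  · simpa [Function.comp_def] using Complex.reCLM.contDiff.comp (contDiff_fst (E := ℂ) (F := ℂ))
  · simpa [Function.comp_def] using Complex.imCLM.contDiff.comp (contDiff_fst (E := ℂ) (F := ℂ))
  · simpa [Function.comp_def] using Complex.reCLM.contDiff.comp (contDiff_snd (E := ℂ) (F := ℂ))
  · simpa [Function.comp_def] using Complex.imCLM.contDiff.comp (contDiff_snd (E := ℂ) (F := ℂ))

/-- Each factor `z ↦ (z - c)/‖z - c‖` of the twist unit `u` is real-smooth off `c`. [folklore] -/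
theorem sectorBlind_contDiffAt_unitFactor {c z : ℂ} (hz : z ≠ c) :
    ContDiffAt ℝ ∞ (fun y : ℂ ↦ (y - c) / ((‖y - c‖ : ℝ) : ℂ)) z := by
  have h1 : ContDiffAt ℝ ∞ (fun y : ℂ ↦ y - c) z := contDiffAt_id.sub contDiffAt_const
  have h2 : ContDiffAt ℝ ∞ (fun y : ℂ ↦ ((‖y - c‖ : ℝ) : ℂ)) z :=
    Complex.ofRealCLM.contDiff.contDiffAt.comp z (h1.norm ℂ (sub_ne_zero.2 hz))
  have h3 : ((‖z - c‖ : ℝ) : ℂ) ≠ 0 := by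
    exact_mod_cast norm_ne_zero_iff.2 (sub_ne_zero.2 hz)
  simp only [div_eq_mul_inv]
  exact h1.mul (h2.inv h3)

/-- An integer power of a nonvanishing real-smooth complex-valued function is real-smooth.
[folklore] -/
theorem sectorBlind_contDiffAt_zpow {E : Type*} [NormedAddCommGroup E] [NormedSpace ℝ E]
    {f : E → ℂ} {x : E} (hf : ContDiffAt ℝ ∞ f x) (h0 : f x ≠ 0) (k : ℤ) :
    ContDiffAt ℝ ∞ (fun y ↦ f y ^ k) x := by
  obtain ⟨m, rfl | rfl⟩ := Int.eq_nat_or_neg k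
  · simp only [zpow_natCast]
    exact hf.pow m
  · simp only [zpow_neg, zpow_natCast]
    exact (hf.pow m).inv (pow_ne_zero m h0)

/-- The twist unit `u(z) = Π_i (z - c_i)/‖z - c_i‖` is real-smooth off the hole centres.
[folklore] -/
theorem sectorBlind_contDiffAt_twistUnit {z : ℂ} (hz : ∀ i : Fin r, z ≠ holeCentre r i) :
    ContDiffAt ℝ ∞ (twistUnit r) z := by
  unfold twistUnit
  exact contDiffAt_prod fun i _ ↦ sectorBlind_contDiffAt_unitFactor (hz i)

/-- **The sphere twist `σ^k` is real-smooth off the poles** `{z = c_i}` (an open set containing the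
model boundary `∂D_r`). [cite: ManolescuMarengonSarkarWillis2023, §2.3] -/
theorem sectorBlind_contDiffAt_sphereTwist (k : ℤ) {x : EuclideanSpace ℝ (Fin 4)}
    (hx : ∀ i : Fin r, zC x ≠ holeCentre r i) : ContDiffAt ℝ ∞ (sphereTwist r k) x := by
  have hz : ContDiffAt ℝ ∞ zC x := sectorBlind_contDiff_zC.contDiffAt
  have hw : ContDiffAt ℝ ∞ wC x := sectorBlind_contDiff_wC.contDiffAt
  have hu : ContDiffAt ℝ ∞ (fun y ↦ twistUnit r (zC y)) x :=
    (sectorBlind_contDiffAt_twistUnit hx).comp x hz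
  have huk : ContDiffAt ℝ ∞ (fun y ↦ twistUnit r (zC y) ^ k) x :=
    sectorBlind_contDiffAt_zpow hu (twistUnit_ne_zero hx) k
  unfold sphereTwist
  exact sectorBlind_contDiff_ofZW.contDiffAt.comp x (hz.prodMk (hw.mul huk))

/-- A smooth map of a manifold into `ℝ⁴` missing the poles stays smooth after a sphere twist.
[folklore] -/
theorem sectorBlind_contMDiff_comp {E : Type*} [NormedAddCommGroup E] [NormedSpace ℝ E]
    {H : Type*} [TopologicalSpace H] {I : ModelWithCorners ℝ E H} {M : Type*}
    [TopologicalSpace M] [ChartedSpace H M] {f : M → EuclideanSpace ℝ (Fin 4)}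
    (hf : ContMDiff I 𝓘(ℝ, EuclideanSpace ℝ (Fin 4)) ∞ f)
    (hU : ∀ p, ∀ i : Fin r, zC (f p) ≠ holeCentre r i) (k : ℤ) :
    ContMDiff I 𝓘(ℝ, EuclideanSpace ℝ (Fin 4)) ∞ (sphereTwist r k ∘ f) :=
  fun p ↦ (sectorBlind_contDiffAt_sphereTwist k (hU p)).comp_contMDiffAt (hf p)

/-! ## Sphere twists of model knots and of isotopies -/

/-- **A sphere twist of a model knot is a model knot**: smooth by the above, on `∂D_r` by
`sphereTwist_mem_modelBoundary`, injective with injective differential because `σ^{-k}` is a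
smooth left inverse on `∂D_r` (chain rule). [cite: ManolescuMarengonSarkarWillis2023, §2.3] -/
theorem sectorBlind_isModelKnot_comp (hL : IsModelKnot r L) (k : ℤ) :
    IsModelKnot r (sphereTwist r k ∘ L) := by
  have hg : ∀ t, ∀ i : Fin r, (1 : ℝ) ≤ holeTerm r i (L t) := fun t ↦ (hL.mem t).1
  have hU : ∀ t, ∀ i : Fin r, zC (L t) ≠ holeCentre r i := fun t ↦ zC_ne_holeCentre (hg t)
  have hinv : sphereTwist r (-k) ∘ (sphereTwist r k ∘ L) = L :=
    funext fun t ↦ sphereTwist_neg_sphereTwist (hg t) k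
  have hsm : ContMDiff (𝓡 1) 𝓘(ℝ, EuclideanSpace ℝ (Fin 4)) ∞ (sphereTwist r k ∘ L) :=
    sectorBlind_contMDiff_comp hL.1 hU k
  refine ⟨hsm, fun t t' h ↦ hL.2.1 ?_, fun t ↦ ?_,
    fun t ↦ sphereTwist_mem_modelBoundary (hL.mem t) k⟩
  · have h' := congrArg (sphereTwist r (-k)) h
    simpa only [Function.comp_apply, sphereTwist_neg_sphereTwist (hg _)] using h'
  · have hU' : ∀ i : Fin r, zC ((sphereTwist r k ∘ L) t) ≠ holeCentre r i := fun i ↦ by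
      rw [Function.comp_apply, zC_sphereTwist]
      exact hU t i
    have h1 : MDifferentiableAt 𝓘(ℝ, EuclideanSpace ℝ (Fin 4)) 𝓘(ℝ, EuclideanSpace ℝ (Fin 4))
        (sphereTwist r (-k)) ((sphereTwist r k ∘ L) t) :=
      ((sectorBlind_contDiffAt_sphereTwist (-k) hU').differentiableAt (by simp)).mdifferentiableAt
    have h2 : MDifferentiableAt (𝓡 1) 𝓘(ℝ, EuclideanSpace ℝ (Fin 4)) (sphereTwist r k ∘ L) t :=
      hsm.mdifferentiableAt (by simp)
    have h3 := hL.2.2.1 t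
    rw [← hinv, mfderiv_comp t h1 h2] at h3
    have h4 : Injective
        ((mfderiv 𝓘(ℝ, EuclideanSpace ℝ (Fin 4)) 𝓘(ℝ, EuclideanSpace ℝ (Fin 4))
            (sphereTwist r (-k)) ((sphereTwist r k ∘ L) t)) ∘
          (mfderiv (𝓡 1) 𝓘(ℝ, EuclideanSpace ℝ (Fin 4)) (sphereTwist r k ∘ L) t)) := h3
    exact h4.of_comp

/-- **A sphere twist of a smooth isotopy of model knots is one** (compose the family with `σ^k`).
[cite: ManolescuMarengonSarkarWillis2023, Thm. 2.8] -/
theorem sectorBlind_isSmoothModelIsotopy_comp (h : IsSmoothModelIsotopy r K K') (k : ℤ) :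
    IsSmoothModelIsotopy r (sphereTwist r k ∘ K) (sphereTwist r k ∘ K') := by
  obtain ⟨H, hH, h0, h1, hK⟩ := h
  refine ⟨fun s ↦ sphereTwist r k ∘ H s, ?_, fun s hs ↦ ?_, fun s hs ↦ ?_,
    fun s ↦ sectorBlind_isModelKnot_comp (hK s) k⟩
  · exact sectorBlind_contMDiff_comp hH
      (fun p i ↦ zC_ne_holeCentre ((hK p.1).mem p.2).1 i) k
  · show sphereTwist r k ∘ H s = _
    rw [h0 s hs]
  · show sphereTwist r k ∘ H s = _
    rw [h1 s hs]

/-- Sphere twists of isotopic model knots are isotopic (chains of smooth isotopies).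
[cite: ManolescuMarengonSarkarWillis2023, Thm. 2.8] -/
theorem sectorBlind_isModelIsotopic_comp (h : IsModelIsotopic r K K') (k : ℤ) :
    IsModelIsotopic r (sphereTwist r k ∘ K) (sphereTwist r k ∘ K') := by
  induction h with
  | single h => exact (sectorBlind_isSmoothModelIsotopy_comp h k).isModelIsotopic
  | tail _ h ih => exact ih.trans (sectorBlind_isSmoothModelIsotopy_comp h k).isModelIsotopic

/-! ## `s₋` and `s₊` are `σ`-blind -/

/-- Null-homology only sees `z ∘ K`, which the sphere twists do not move. [folklore] -/
theorem sectorBlind_isNullHomologous_comp_iff (k : ℤ) :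
    IsNullHomologous r (sphereTwist r k ∘ K) ↔ IsNullHomologous r K := by
  simp only [IsNullHomologous, Function.comp_apply, zC_sphereTwist]

/-- `D(k⃗)(σ^j K) = D(k⃗ + j⃗)(K)`, read through `ApproxHasRasmussen`.
[cite: ManolescuMarengonSarkarWillis2023, Thm. 2.8 (proof)] -/
theorem sectorBlind_approxHasRasmussen_comp_iff (hK : ∀ t, K t ∈ modelBoundary r) (j k s : ℤ) :
    ApproxHasRasmussen r k (sphereTwist r j ∘ K) s ↔ ApproxHasRasmussen r (j + k) K s := by
  simp only [ApproxHasRasmussen, finiteApprox_sphereTwist_comp hK]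

/-- **`s₋(K) = s ⟹ s₋(σ^j ∘ K) = s`**: transport the null-homology, the core-missing representative
(along `σ^j`) and shift the threshold by `j`. [cite: ManolescuMarengonSarkarWillis2023, Thm. 2.8] -/
theorem sectorBlind_hasSMinus_comp {s : ℤ} (h : HasSMinus r K s) (j : ℤ) :
    HasSMinus r (sphereTwist r j ∘ K) s := by
  obtain ⟨h0, K'', hiso, hw, k₀, hk⟩ := h
  have hK'' : IsModelKnot r K'' := hiso.isModelKnot_right
  refine ⟨(sectorBlind_isNullHomologous_comp_iff j).2 h0, sphereTwist r j ∘ K'',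
    sectorBlind_isModelIsotopic_comp hiso j, fun t ↦ ?_, k₀ - j, fun k hk' ↦ ?_⟩
  · rw [Function.comp_apply, wC_sphereTwist]
    exact mul_ne_zero (hw t)
      (zpow_ne_zero _ (twistUnit_ne_zero (zC_ne_holeCentre (hK''.mem t).1)))
  · rw [sectorBlind_approxHasRasmussen_comp_iff hK''.mem]
    exact hk (j + k) (by omega)

/-- `σ^{-j} ∘ σ^{j} ∘ K = K` for a loop on the model boundary. [folklore] -/
theorem sectorBlind_neg_comp_comp (hK : ∀ t, K t ∈ modelBoundary r) (j : ℤ) :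
    sphereTwist r (-j) ∘ (sphereTwist r j ∘ K) = K :=
  funext fun t ↦ sphereTwist_neg_sphereTwist (hK t).1 j

/-- **`s₋(σ^j ∘ K) = s ↔ s₋(K) = s`** (the converse is the direct statement for `σ^{-j}`).
[cite: ManolescuMarengonSarkarWillis2023, Thm. 2.8] -/
theorem sectorBlind_hasSMinus_iff (hK : ∀ t, K t ∈ modelBoundary r) (j s : ℤ) :
    HasSMinus r (sphereTwist r j ∘ K) s ↔ HasSMinus r K s := by
  refine ⟨fun h ↦ ?_, fun h ↦ sectorBlind_hasSMinus_comp h j⟩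
  have h' := sectorBlind_hasSMinus_comp h (-j)
  rwa [sectorBlind_neg_comp_comp hK] at h'

/-- `ρ ∘ σ^j = σ^{-j} ∘ ρ` on the model boundary: the hole centres are real, so
`u(z̄) = conj u(z) = u(z)⁻¹`. [folklore] -/
theorem sectorBlind_modelMirror_sphereTwist {x : EuclideanSpace ℝ (Fin 4)}
    (hx : ∀ i : Fin r, (1 : ℝ) ≤ holeTerm r i x) (j : ℤ) :
    modelMirror (sphereTwist r j x) = sphereTwist r (-j) (modelMirror x) := by
  have hz := zC_ne_holeCentre hx
  have hu1 : ‖twistUnit r (zC x)‖ = 1 := norm_twistUnit hz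
  have hinv : conj (twistUnit r (zC x)) = (twistUnit r (zC x))⁻¹ := by
    rw [Complex.inv_def, Complex.normSq_eq_norm_sq, hu1]
    simp
  have e1 : zC (modelMirror (sphereTwist r j x)) = zC (sphereTwist r (-j) (modelMirror x)) := by
    simp only [zC_modelMirror, zC_sphereTwist]
  have e2 : wC (modelMirror (sphereTwist r j x)) = wC (sphereTwist r (-j) (modelMirror x)) := by
    simp only [wC_modelMirror, wC_sphereTwist, zC_modelMirror, twistUnit_conj, hinv, inv_zpow',
      neg_neg]
  rw [← ofZW_zC_wC (modelMirror (sphereTwist r j x)), e1, e2, ofZW_zC_wC]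

/-- **`s₊(σ^j ∘ K) = s ↔ s₊(K) = s`**: `s₊(K) = s` is `s₋(ρ ∘ K) = -s`, and `ρ ∘ σ^j = σ^{-j} ∘ ρ`.
[cite: ManolescuMarengonSarkarWillis2023, Thm. 2.8] -/
theorem sectorBlind_hasSPlus_iff (hK : ∀ t, K t ∈ modelBoundary r) (j s : ℤ) :
    HasSPlus r (sphereTwist r j ∘ K) s ↔ HasSPlus r K s := by
  have hc : modelMirror ∘ (sphereTwist r j ∘ K) = sphereTwist r (-j) ∘ (modelMirror ∘ K) :=
    funext fun t ↦ sectorBlind_modelMirror_sphereTwist (hK t).1 j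
  rw [hasSPlus_iff, hasSPlus_iff, hc]
  exact sectorBlind_hasSMinus_iff (fun t ↦ (modelMirror_mem_modelBoundary_iff _).2 (hK t))
    (-j) (-s)

/-- **Sector blindness** (stub `stub_sectorBlind` of line `Sketch`, crux `DcrGap`; MMSW Thm. 2.8
for the sphere twists). For a loop `K` on `∂D_r` and every `j ∈ ℤ`: `s₋(σ^j ∘ K) = s ↔ s₋(K) = s`
and `s₊(σ^j ∘ K) = s ↔ s₊(K) = s`. Mechanism: `D(k⃗)(σ^j K') = D(k⃗ + j⃗)(K')`
(`MMSW.finiteApprox_sphereTwist_comp`) shifts the eventual value; null-homologies and isotopies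
through model knots are transported along the diffeomorphism `σ^j` of `∂D_r`; for `s₊`,
`ρ ∘ σ^j = σ^{-j} ∘ ρ`. [cite: ManolescuMarengonSarkarWillis2023, Thm. 2.8] -/
theorem stub_sectorBlind : ∀ (r : ℕ) (K : (Metric.sphere (0 : EuclideanSpace ℝ (Fin 2)) 1) → EuclideanSpace ℝ (Fin 4)) (j s : ℤ), (∀ t, K t ∈ Literature.Topology.FourManifolds.MMSW.modelBoundary r) → (Literature.Topology.FourManifolds.MMSW.HasSMinus r (Literature.Topology.FourManifolds.MMSW.sphereTwist r j ∘ K) s ↔ Literature.Topology.FourManifolds.MMSW.HasSMinus r K s) ∧ (Literature.Topology.FourManifolds.MMSW.HasSPlus r (Literature.Topology.FourManifolds.MMSW.sphereTwist r j ∘ K) s ↔ Literature.Topology.FourManifolds.MMSW.HasSPlus r K s) :=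
  fun _ _ j s hK ↦ ⟨sectorBlind_hasSMinus_iff hK j s, sectorBlind_hasSPlus_iff hK j s⟩

end Summit.SmoothPoincare4.SmoothPoincare4.Theorems.DcrGap.Sketch

end
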